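import Summits.QuantumFields.YangMills.Theorems.UnitScaleTiltProp8FlatPortKernelRowsL0
import HarnessLib

/-!
# Route `UnitScaleTilt`, crux K1 child «MinimiserStabilityRegPr» (stmt-QuantumFields-19200), v8 pillar P2 — port level, **THE `G`-ROW AT NAMED BAND WEIGHTS**
# (owner socket (σ-3), file 3: the supplier of `HalvingMultiplierLetter`'s `(w′, G, IsFlatGW, GtSupLetterG, band)` package): for odd `L ≥ 5`, at every admissible
# datum of the P2 text (`Adm22` families with unit cubes allowed, tori with `≥ 5L` big blocks), the genuine propagator `G_a` at lit-balaban's band weights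
# `w♯(c) = (L^{K−n}/L^{j(c)})²(L^{j(c)})³ = (L^{K−n})²·L^{j(c)}` is pinned (`IsFlatGW`), has the (2.136)₁,₂ sup letter `GtSupLetterG`, AND the band is DISPLAYED —
# the registered `RowsAt`/`KernelRowsAt` (p1 g17/g18 `FlatPortKernelRowsL0.kernelRowsAt_domT`) construct exactly these weights but hide them behind `∃ w′`

Cell `ym3-torus` (HUMAN RULING D-0037, YM ladder rung R3 — continuum SU(2) YM₃ on the torus is a RUNG, not the Clay problem), width seat
`ym-ust-19200-w3` gen 3 (D-0149).  `--supports stmt-QuantumFields-19200 --as helper`; def-free, 0 sorry, standard axioms.  The proof is the `G`-half of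
`FlatPortKernelRowsL0.kernelRowsAt_domT`/`kernelRowsAt_of_adm22` VERBATIM (lit-balaban's `prop26_2136_lap_kLevel_unconditional_pad_V1` at the unit band, Lemma 2.1 on the torus
at rate `δ₃/2`, the absorption budget, `FlatPortGRowsL0.gRows_of_portShapes`), with the weights kept in the conclusion.

WHY ([Balaban1985Variational] p. 298 «the right-hand side of (133) can be estimated by O(1)…»): the multiplier operator `𝔐 = Q*(QGQ*)⁻¹QG` of the E–L junction
(`HalvingELJunction`) splits as `∂*∂H(QG_af) + Q*(a·QG_af)` for ANY auxiliary weights `a` (`HalvingMultiplierLetter.QsE_EE_QE_GE_eq_of_weights`); the second term is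
controlled only when `a` is in print's band (2.16) — `a(c) ≤ (L^{K−n})²L^{j(c)}` in the tree's normalisation — which is where the port's `G`-rows live.

WHAT IS PROVED (sorry-free; axioms standard; no definition):
* `band_unitWeights` — the port's weights satisfy `w♯(c) ≤ (L^{K−n})²·L^{j(c)}` (equality).
* **`gBand_domT`** — at every charted family of the d = 3 carrier (odd `L ≥ 5`, `k ≥ 1`): `∃ w′ > 0, G` with `IsFlatGW … w′ G ∧ GtSupLetterG … w G C_G ∧ ∀ c, w′ c ≤ (L^{K−n})²L^{j(c)}`,
  ONE constant `C_G ≥ 0` (function of `L`).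
* **`gBand_of_adm22`** — the same at every `Adm22` family `D : Domains (F.P K)` of the text (the recharting `FlatPortChartL0.domT_tdOfAdmL0`).
HONEST SCOPE.  Bookkeeping over lit-balaban's kernel-checked k-level (2.136) chain; what separates it from all `L` is exactly (P2-L3)/(P2-small) as for the P2 body.  NOT a
claim about the crux, the rung, or the mass gap.

References: T. Bałaban, CMP **96** (1984) 223–250 [Balaban1984PropagatorsII] (2.16) p.225, Prop. 2.6 (2.136) p.247, Lemma 2.1 (2.60)–(2.61) p.234; CMP **102** (1985) 277–309
[Balaban1985Variational] (133) p.298, (165) p.304.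
-/

set_option autoImplicit false

noncomputable section

open scoped BigOperators InnerProductSpace

namespace Summit.QuantumFields.YangMills.Theorems.FlatPortGBandL0

open Literature.MathematicalPhysics.QuantumFieldTheory.Balaban1983to89
open Literature.MathematicalPhysics.QuantumFieldTheory.BalabanImbrieJaffe1984to88.BIJ85AxialPropagator411 (BondSpace)
open B6MultiLevelBoxOperator (N0)
open B6MultiLevelTorusOperatorL0 (TDomains)
open B6Geom246MultiLevelBoxL0 (bset)
open B6Geom246MultiLevelTorusL0 (geomT bondT lemma21_torus)
open B6GlobalChartV1 (PV toBox)
open B6GlobalChartV1L0 (blkV1 domT)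
open B6Ineq2133TwoScaleV1 (onFun)
open B6RandomWalk (HasMajorant delta3 delta3_pos)
open B6Lemma21Repaired (Ineq261With)
open B6Ineq261LevelGap (K261 K261_nonneg)
open B6Cor28KLevelV1 (two_le_RMh)
open B6CubeWindowV1 (GlobalBand)
open B6SectAOperatorsV1 (BondIdx)
open B6SectAVectorModelV1 (GE)
open T3ContinuumYM3Torus (T3Family)
open FlatCubeOpsText (IsLevWeight GtSupLetterG Adm22)
open FlatOpsLettersAssembly (IsFlatGW)
open FlatPortKernelRows (theta_budget absorb_budget chart_params)
open FlatPortHRows12 (cf_ne_zero)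
open FlatPortGRowsL0 (gRows_of_portShapes)
open FlatPortKernelRowsL0 (globalBand_unitWeights unitWeights_pos)
open B6Prop26LapKLevelV1L0 (prop26_2136_lap_kLevel_unconditional_pad_V1)

/-- `1 ≤ 3` (named once). [folklore] -/
private theorem hd3 : 1 ≤ 2 + 1 := by norm_num

section Carrier

variable (ℓ : ℕ) (hL : Odd (ℓ + 1) ∧ 1 < ℓ + 1) (m : ℕ) (hm : 1 ≤ m) (n K : ℕ)
variable {Mh R : ℕ} {P' : Fin (2 + 1) → ℕ}
variable (hN : ∀ μ, N0 ℓ Mh (K - n) P' μ = (PV 2 ℓ m K hd3 hL).sitesPerDir 0) (D : TDomains 2 ℓ Mh (K - n) P' R) (hk : K - n ≤ m + K)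

/-- **THE BAND OF THE PORT'S WEIGHTS**: `w♯(c) = (L^{K−n}/L^{j(c)})²(L^{j(c)})³ ≤ (L^{K−n})²·L^{j(c)}` (equality: `(a/b)²b³ = a²b`).
[cite: Balaban1984PropagatorsII, (2.16) p.225] -/
theorem band_unitWeights (c : BondIdx (B6GlobalChartV1L0.domT hN D hk)) :
    ((((ℓ + 1 : ℕ) : ℝ)) ^ (K - n) / (((ℓ + 1 : ℕ) : ℝ)) ^ (c.1.1 : ℕ)) ^ 2 * ((((ℓ + 1 : ℕ) : ℝ)) ^ (c.1.1 : ℕ)) ^ (2 + 1) ≤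
      ((((ℓ + 1 : ℕ) : ℝ)) ^ (K - n)) ^ 2 * (((ℓ + 1 : ℕ) : ℝ)) ^ (c.1.1 : ℕ) := by
  have hb : ((((ℓ + 1 : ℕ) : ℝ)) ^ (c.1.1 : ℕ)) ≠ 0 := pow_ne_zero _ (by exact_mod_cast Nat.succ_ne_zero ℓ)
  apply le_of_eq
  field_simp

/-- **THE `G`-ROW AT NAMED BAND WEIGHTS, EVERY CHARTED FAMILY OF THE d = 3 CARRIER** (odd `L ≥ 5`, `k ≥ 1`): ONE constant `C_G ≥ 0` and thresholds `M_h⁰, R₀` (functions of `L`)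
such that for every height, every torus family with `M_h = Lᵃ ≥ M_h⁰`, `R ≥ R₀`, `P′ = L·P″`, `P″ ≥ 5` and every P2 weight family `w`, there are positive weights `w′` IN THE BAND
`w′(c) ≤ (L^{K−n})²L^{j(c)}` and the pinned genuine propagator `G` (`IsFlatGW`) with `GtSupLetterG F n K w G C_G` — the `G`-half of `FlatPortKernelRowsL0.kernelRowsAt_domT` with the
weights displayed. [cite: Balaban1984PropagatorsII, (2.16) p.225, Prop. 2.6 (2.136) p.247, Lemma 2.1 (2.60)-(2.61) p.234] -/
theorem gBand_domT (ℓ : ℕ) (hL : Odd (ℓ + 1) ∧ 1 < ℓ + 1) (hℓ : 4 ≤ ℓ) :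
    ∃ (Mh₀ R₀ : ℕ) (CG : ℝ), 0 ≤ CG ∧
    ∀ (m : ℕ) (hm : 1 ≤ m) (n K : ℕ) {Mh R : ℕ} {P' : Fin (2 + 1) → ℕ} (hN : ∀ μ, N0 ℓ Mh (K - n) P' μ = (PV 2 ℓ m K hd3 hL).sitesPerDir 0)
      (D : TDomains 2 ℓ Mh (K - n) P' R) (hk : K - n ≤ m + K) (_ : 1 ≤ K - n)
      {P'' : Fin (2 + 1) → ℕ} (_ : ∀ μ, P' μ = (ℓ + 1) * P'' μ) (_ : ∀ μ, 5 ≤ P'' μ)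
      {a : ℕ} (_ : Mh = (ℓ + 1) ^ a) (_ : Mh₀ ≤ Mh) (_ : R₀ ≤ R)
      (w : ℕ → PBond (PV 2 ℓ m K hd3 hL) 0 → ℝ) (_ : IsLevWeight (⟨ℓ + 1, hL, m, hm⟩ : T3Family) n K (B6GlobalChartV1L0.domT hN D hk) w),
      ∃ (w' : BondIdx (domT hN D hk) → ℝ) (hw' : ∀ i, 0 < w' i)
        (G : (PBond (PV 2 ℓ m K hd3 hL) 0 → ℝ) →ₗ[ℝ] (PBond (PV 2 ℓ m K hd3 hL) 0 → ℝ)),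
        IsFlatGW (⟨ℓ + 1, hL, m, hm⟩ : T3Family) n K (domT hN D hk) hw' G ∧ GtSupLetterG (⟨ℓ + 1, hL, m, hm⟩ : T3Family) n K w G CG ∧
        ∀ c : BondIdx (domT hN D hk), w' c ≤ ((((ℓ + 1 : ℕ) : ℝ)) ^ (K - n)) ^ 2 * (((ℓ + 1 : ℕ) : ℝ)) ^ (c.1.1 : ℕ) := by
  -- the (2.136) package at the unit band `b₀ = b₁ = 1`
  obtain ⟨σc, hσc, hC⟩ := prop26_2136_lap_kLevel_unconditional_pad_V1 2 ℓ hd3 hL one_pos (le_refl (1 : ℝ))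
  obtain ⟨A, M₂c, hA0, hM₂c, hrowsC⟩ := hC σc hσc le_rfl (1 / 2) (by norm_num) (by norm_num)
  -- the rate
  set δ₃ : ℝ := delta3 (1 / 2) (2 * σc) with hδ₃
  have hδ₃0 : 0 < δ₃ := delta3_pos (by norm_num) (by linarith)
  -- Lemma-2.1 budget at rate `δ₃/2` and the absorption threshold
  obtain ⟨hNgpos, hθg⟩ := theta_budget ℓ (show 0 < 1 / 2 * δ₃ by positivity)
  set Ng : ℕ := ⌈2 * ((2 + 1 : ℕ) : ℝ) * Real.log ((ℓ : ℝ) + 1) / (1 / 2 * δ₃)⌉₊ + 1 with hNg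
  set Nag : ℕ := ⌈2 * ((2 : ℝ) + 3) * ((ℓ : ℝ) + 1) / δ₃⌉₊ with hNag
  set Lr : ℝ := (ℓ : ℝ) + 1 with hLr
  have hL1 : (1 : ℝ) ≤ Lr := by rw [hLr]; linarith [(Nat.cast_nonneg ℓ : (0 : ℝ) ≤ ℓ)]
  set c1g : ℝ := K261 Ng (2 + 1) Lr 1 (1 / 2 * δ₃) with hc1g
  have hc1g0 : 0 ≤ c1g := K261_nonneg (by linarith : (0 : ℝ) ≤ Lr) zero_le_one
  -- thresholds
  set Mh₀ : ℕ := max 8 ⌈M₂c⌉₊ with hMh₀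
  set R₀ : ℕ := max (2 * (ℓ + 1) ^ 2) (max (Ng + 1) (Nag + 1)) with hR₀
  refine ⟨Mh₀, R₀, A * Lr ^ 3 * c1g, by positivity, ?_⟩
  intro m hm n K Mh R P' hN D hk hk1 P'' hLP hP5 a hMha hMh hR w hw
  have hM8 : 8 ≤ Mh := le_trans (le_max_left _ _) hMh
  have hMh1 : 1 ≤ Mh := le_trans (by norm_num) hM8
  have hR2 : 2 * (ℓ + 1) ^ 2 ≤ R := le_trans (le_max_left _ _) hR
  have hRLM : ∀ {N : ℕ}, N + 1 ≤ R₀ → N + 1 ≤ R * ((ℓ + 1) * Mh) := fun {N} h =>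
    le_trans (le_trans h hR) (Nat.le_mul_of_pos_right R (Nat.mul_pos (Nat.succ_pos ℓ) (by omega)))
  have hNg' : Ng + 1 ≤ R * ((ℓ + 1) * Mh) := hRLM (le_trans (le_max_left _ _) (le_max_right _ _))
  have hNag' : Nag + 1 ≤ R * ((ℓ + 1) * Mh) := hRLM (le_trans (le_max_right _ _) (le_max_right _ _))
  have hRM1 : 1 ≤ R * ((ℓ + 1) * Mh) := le_trans (by omega) hNg'
  have hM₂c' : M₂c ≤ ((ℓ : ℝ) + 1) * Mh := by
    have h1 : M₂c ≤ (⌈M₂c⌉₊ : ℝ) := Nat.le_ceil _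
    have h2 : (⌈M₂c⌉₊ : ℝ) ≤ (Mh : ℝ) := by exact_mod_cast le_trans (le_max_right _ _) hMh
    have h3 : (Mh : ℝ) ≤ ((ℓ : ℝ) + 1) * Mh := le_mul_of_one_le_left (Nat.cast_nonneg _) hL1
    linarith
  have hP1 : ∀ μ, 1 ≤ P' μ := fun μ => by rw [hLP μ]; exact Nat.mul_pos (Nat.succ_pos ℓ) (by have := hP5 μ; omega)
  have hP5L : ∀ μ, 5 * (ℓ + 1) ≤ P' μ := fun μ => by rw [hLP μ, mul_comm]; exact Nat.mul_le_mul_left _ (hP5 μ)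
  -- the band weights
  set ws : BondIdx (domT hN D hk) → ℝ := fun i =>
    ((((ℓ + 1 : ℕ) : ℝ)) ^ (K - n) / (((ℓ + 1 : ℕ) : ℝ)) ^ (i.1.1 : ℕ)) ^ 2 * ((((ℓ + 1 : ℕ) : ℝ)) ^ (i.1.1 : ℕ)) ^ (2 + 1) with hws_def
  have hws : ∀ i, 0 < ws i := unitWeights_pos ℓ hL m n K hN D hk
  have hband : GlobalBand (Dm := domT hN D hk) 1 1 ((((ℓ + 1 : ℕ) : ℝ)) ^ (K - n)) ws := globalBand_unitWeights ℓ hL m n K hN D hk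
  -- the (2.136) majorants at these data
  obtain ⟨hGm, hDGm, hLapm⟩ := hrowsC m K hN D hk hk1 hMha hM8 hR2 hP5L hℓ hM₂c' (cf_ne_zero ℓ n K) hws hband
  -- Lemma 2.1 on the torus at rate `δ₃` and the absorption threshold
  obtain ⟨-, h261g, -, -⟩ := lemma21_torus (D := D) hMh1 hP1 hNgpos hNg' hδ₃0.le (by norm_num : (0 : ℝ) ≤ 1 / 2) (by norm_num : (1 : ℝ) / 2 ≤ 1) hθg
  obtain ⟨-, hsmg, -⟩ := absorb_budget ℓ hδ₃0 hNag'
  obtain ⟨hflat, hsup, -⟩ := gRows_of_portShapes ℓ hL m hm n K hN D hk hMh1 hP1 hRM1 hws hA0 hδ₃0.le hGm hDGm hLapm hsmg h261g w hw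
  exact ⟨ws, hws, _, hflat, hsup, fun c => band_unitWeights ℓ hL m n K hN D hk c⟩

end Carrier

/-- **THE `G`-ROW AT NAMED BAND WEIGHTS, EVERY ADMISSIBLE FAMILY OF THE P2 TEXT** (no `Ω₁ = T` hypothesis; unit cubes `Λ₀` allowed; via `FlatPortChartL0.tdOfAdmL0`/`domT_tdOfAdmL0`):
for odd `L = ℓ + 1 ≥ 5` there are `M_h⁰, R₀` and ONE `C_G ≥ 0` such that for all `m ≥ 1`, heights `1 ≤ K − n`, `K − n + 1 ≤ m + K`, big blocks `M = L·M_h`, `M_h = L^{a′} ≥ M_h⁰`,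
`R ≥ R₀`, torus size `a′ + 3 ≤ m + n`, every `D : Domains (F.P K)` with `D.k = K − n`, `Adm22 D R (L·M_h)`, and every P2 weight family `w`:
`∃ w′ > 0, G`, `IsFlatGW F n K D w′ G ∧ GtSupLetterG F n K w G C_G ∧ ∀ c, w′ c ≤ (L^{K−n})²L^{j(c)}` — the supplier of `HalvingMultiplierLetter.multiplierLetter_layer`'s `G`-package.
[cite: Balaban1984PropagatorsII, (2.1)-(2.2) p.224, (2.16) p.225, Prop. 2.6 (2.136) p.247; Balaban1985Variational, (133) p.298, (165) p.304] -/
theorem gBand_of_adm22 (ℓ : ℕ) (hL : Odd (ℓ + 1) ∧ 1 < ℓ + 1) (hℓ : 4 ≤ ℓ) :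
    ∃ (Mh₀ R₀ : ℕ) (CG : ℝ), 0 ≤ CG ∧
    ∀ (m : ℕ) (hm : 1 ≤ m) (n K : ℕ) (_ : 1 ≤ K - n) (_ : K - n + 1 ≤ m + K) {Mh R a' : ℕ} (_ : Mh = (ℓ + 1) ^ a') (_ : Mh₀ ≤ Mh) (_ : R₀ ≤ R) (_ : a' + 3 ≤ m + n)
      (D : B6SectADomainsV1.Domains (PV 2 ℓ m K hd3 hL)) (_ : D.k = K - n) (_ : Adm22 D R ((ℓ + 1) * Mh))
      (w : ℕ → PBond (PV 2 ℓ m K hd3 hL) 0 → ℝ) (_ : IsLevWeight (⟨ℓ + 1, hL, m, hm⟩ : T3Family) n K D w),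
      ∃ (w' : BondIdx D → ℝ) (hw' : ∀ i, 0 < w' i)
        (G : (PBond (PV 2 ℓ m K hd3 hL) 0 → ℝ) →ₗ[ℝ] (PBond (PV 2 ℓ m K hd3 hL) 0 → ℝ)),
        IsFlatGW (⟨ℓ + 1, hL, m, hm⟩ : T3Family) n K D hw' G ∧ GtSupLetterG (⟨ℓ + 1, hL, m, hm⟩ : T3Family) n K w G CG ∧
        ∀ c : BondIdx D, w' c ≤ ((((ℓ + 1 : ℕ) : ℝ)) ^ (K - n)) ^ 2 * (((ℓ + 1 : ℕ) : ℝ)) ^ (c.1.1 : ℕ) := by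
  obtain ⟨Mh₀, R₀, CG, hCG, hmain⟩ := gBand_domT ℓ hL hℓ
  refine ⟨Mh₀, R₀, CG, hCG, ?_⟩
  intro m hm n K hk1 hk' Mh R a' hMha hMh hR hsize D hDk hAdm w hw
  have hk : K - n ≤ m + K := by omega
  obtain ⟨hN, hLP, hP5⟩ := chart_params ℓ m n K a' hL hℓ hk1 hsize
  have hN' : ∀ μ : Fin (2 + 1), N0 ℓ Mh (K - n) (fun _ => 2 * (ℓ + 1) ^ (m + n - 1 - a')) μ = (PV 2 ℓ m K hd3 hL).sitesPerDir 0 := by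
    rw [hMha]; exact hN
  set D' := FlatPortChartL0.tdOfAdmL0 hN' D hDk hk hAdm with hD'
  have hEq : domT hN' D' hk = D := FlatPortChartL0.domT_tdOfAdmL0 hN' D hDk hk hAdm
  rw [← hEq] at hw ⊢
  exact hmain m hm n K hN' D' hk hk1 hLP hP5 hMha hMh hR w hw

end Summit.QuantumFields.YangMills.Theorems.FlatPortGBandL0

end
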